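import Literature.IUT.LogVolume.Corollary22Legendre
import Literature.NumberTheory.DiophantineGeometry.GenEllGaloisImageTwist
import Literature.NumberTheory.DiophantineGeometry.LocalReductionHasMultiplicativeReductionAtProofs
import Literature.NumberTheory.DiophantineGeometry.LocalReductionIsIntegralAtProofs
import Literature.NumberTheory.DiophantineGeometry.MinimalDiscriminantNormProofs
import Literature.NumberTheory.EllipticCurves.OpenImageMazurProofs
import Summits.BirchSwinnertonDyer.Rank2.IntModelLocalData
import Mathlib.NumberTheory.Padics.HeightOneSpectrum
import HarnessLib

/-!
# (P6) ENGINE for Frey–Legendre data: `Cor22.CondP6 (ratPoint (a/c)) l` from a Frobenius certificate and one multiplicative prime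

PROOF-ONLY file (D-0012; 0 definitions, 0 `Prop` facts, no instance, no notation) of the abc-iut cell (seat abc-iut-w6-d102, gen 4;
row «C:HSHW-REF», director-abc 21:13:13Z (b)). It turns the recipe of `AbcOfSHwindowFreyRefutationP6.lean` (p476875, the datum
`λ = 2·5¹⁰13⁴/(11⁸109²3677³)`) into a DATUM-PARAMETRIC engine, so that every «modulo (P6)» row of the R-W table (the apices of
W-ref-3's kit `FreyRef.not_hSHwBad_of_row` at the data 167 / 463 / 1061, and any future Frey–Legendre `ratPoint`) is discharged by
ONE kernel point count and a handful of `norm_num` divisibilities.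

(P6) (S. Mochizuki, *Inter-universal Teichmüller theory IV*, RIMS manuscript (Apr. 2020; = PRIMS **57** (2021)), proof of Cor. 2.2 (ii)
p. 46; [IUTchI] Def. 3.1 (c)): "the image of `Gal(Q̄/F) → GL₂(𝔽_l)` determined by the `l`-torsion points of `E_F` contains `SL₂(𝔽_l)`",
`E : y² = x(x−1)(x−λ)`, `F` any theta-field `ℚ(λ)(√−1, E[3·5])` (`Cor22.IsThetaField`, `Cor22.CondP6`). For `λ = a/c ∈ ℚ`:

* §1 the place `v_q` of `ℚ` over a prime `q` (`primesEquiv.symm q`): `(q) = v_q.asIdeal`, `v_q(q) = exp(−1)`, `n ∉ v_q` for `q ∤ n`;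
* §2 an INTEGER model `E` at `v_q`: integral; `q ∤ c₄(E)` ⇒ `v_q(c₄) = 1`; `Δ(E) = q^k·D`, `q ∤ D` ⇒ `v_q(Δ) = exp(−k)`; hence (`k ≥ 1`)
  MULTIPLICATIVE reduction at `v_q` and `ord_q(Δ_min) = k` (Silverman AEC VII.1 Rem. 1.1, VII.5 Prop. 5.1(b); tree
  `isMinimalAt_of_lt_valuation_c₄`, `hasMultiplicativeReductionAt_of_valuation_c₄_eq_one`, `valuation_Δ_eq_of_isMinimalAt_holds`);
* §3 `imageModLContainsSL2_map`: for an integer model, IRREDUCIBLE `ρ̄_l` + such a `q ∤ l` with `l ∤ k` ⇒ `Im(Γ_ℚ → Aut E[l]) ⊇ SL₂(𝔽_l)`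
  ([GenEll] Lem. 3.1 (iii), tree `EllPoint.imageModLContainsSL2_of_not_admitsLCyclic_of_hasMultiplicativeReductionAt`);
* §4 the Frey–Legendre model `E₁ = [0, −(c²+ac), 0, ac³, 0]` (`Δ_model`: `Δ = 16a²c⁸(c−a)²`; `c₄_model`: `c₄ = 16c²(c²−ac+a²)`;
  `⟨c,0,0,0⟩ • E₁ =` Legendre model) and **`condP6_ratPoint_of_certificate`**: hypotheses = `a, c ≠ 0`, `a ≠ c`, prime `l ∤ 46080`, a
  good prime `p ≠ l` (`p ∤ Δ(E₁)`) with `X² − a_p X + p` rootless mod `l` (`a_p` = the tree's `Automorphic.frobeniusTrace E₁ p`; MAZUR'S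
  FROBENIUS CERTIFICATE, tree theorem `Summit.BirchSwinnertonDyer.Rank2.hasIrreducibleModPGaloisRep_map_of_noroot`), and a prime `q ∤ l`,
  `q ∤ c₄(E₁)`, `Δ(E₁) = q^k D`, `q ∤ D`, `0 < k`, `l ∤ k`; conclusion `Cor22.CondP6 (ratPoint (a/c)) l` VERBATIM (UP to every theta-field
  by `EllPoint.imageModLContainsSL2_map_of_isGalois_of_not_dvd`, `[F:ℚ] ∣ 46080`).

HONEST SCOPE: classical, undisputed arithmetic of elliptic curves over `ℚ` (Serre 1972 / Mazur 1978 / Tate); nothing here is about Θ-data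
or [IUTchIII] Cor. 3.12; no side taken on any author; typed ≠ proved for every IUT sentence; no abc claim.
[cite: Mochizuki2012, IUTchIV Cor. 2.2 (ii) proof (P6) p. 46; IUTchI Def. 3.1 (c) p. 62] [cite: Mazur1978, §6 Prop. 6.3 (1) p. 153]
[cite: Serre1972PointsOrdreFini, §2, Prop. 15] [cite: MochizukiGenEll2010, Lem. 3.1 (iii) p. 14] [cite: SilvermanAEC2009, VII.1 Rem. 1.1,
VII.5 Prop. 5.1(b), III.1 Table 3.1] [claim: Mochizuki2012, status: disputed] for every IUT quotation.
-/

noncomputable section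

open scoped Classical
open NumberField IsDedekindDomain WeierstrassCurve

namespace Summit.ABC.IUTFork.Conditional

namespace FreyP6Engine

open Literature.NumberTheory.EllipticCurves Literature.NumberTheory.DiophantineGeometry.GenEll
open Literature.NumberTheory.DiophantineGeometry Literature.IUT.LogVolume

/-! ## §1 The place of `ℚ` over a prime `q` -/

/-- The place of `𝓞_ℚ` over the prime `q` contains `q`. [folklore] -/
theorem natCast_mem_asIdeal (q : ℕ) (hq : q.Prime) :
    (q : 𝓞 ℚ) ∈ ((Rat.HeightOneSpectrum.primesEquiv (R := 𝓞 ℚ)).symm ⟨q, hq⟩).asIdeal := by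
  set v := (Rat.HeightOneSpectrum.primesEquiv (R := 𝓞 ℚ)).symm ⟨q, hq⟩ with hv
  have hgen : Rat.HeightOneSpectrum.natGenerator v = q :=
    congrArg Subtype.val ((Rat.HeightOneSpectrum.primesEquiv (R := 𝓞 ℚ)).apply_symm_apply ⟨q, hq⟩)
  rw [← Ideal.apply_mem_of_equiv_iff (f := Rat.IsIntegralClosure.intEquiv (𝓞 ℚ)), map_natCast,
    ← Rat.HeightOneSpectrum.natGenerator_dvd_iff, hgen]

/-- The place over `q` is the ideal `(q)` of `𝓞_ℚ`. [folklore] -/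
theorem asIdeal_eq_span (q : ℕ) (hq : q.Prime) :
    ((Rat.HeightOneSpectrum.primesEquiv (R := 𝓞 ℚ)).symm ⟨q, hq⟩).asIdeal = Ideal.span {(q : 𝓞 ℚ)} := by
  set v := (Rat.HeightOneSpectrum.primesEquiv (R := 𝓞 ℚ)).symm ⟨q, hq⟩ with hv
  have hgen : Rat.HeightOneSpectrum.natGenerator v = q :=
    congrArg Subtype.val ((Rat.HeightOneSpectrum.primesEquiv (R := 𝓞 ℚ)).apply_symm_apply ⟨q, hq⟩)
  have hspan := Rat.HeightOneSpectrum.span_natGenerator v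
  rw [hgen] at hspan
  rw [← v.asIdeal.comap_map_of_bijective _ (Rat.IsIntegralClosure.intEquiv (𝓞 ℚ)).bijective,
    ← hspan, ← Ideal.map_symm, Ideal.map_span, Set.image_singleton, map_natCast]

/-- A natural number `n` with `q ∤ n` does not lie in the place over `q`. [folklore] -/
theorem natCast_not_mem_asIdeal (q : ℕ) (hq : q.Prime) {n : ℕ} (hn : ¬ q ∣ n) :
    (n : 𝓞 ℚ) ∉ ((Rat.HeightOneSpectrum.primesEquiv (R := 𝓞 ℚ)).symm ⟨q, hq⟩).asIdeal := by
  rw [asIdeal_eq_span, Ideal.mem_span_singleton]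
  intro h
  apply hn
  have h' := map_dvd (Rat.IsIntegralClosure.intEquiv (𝓞 ℚ)) h
  rw [map_natCast, map_natCast] at h'
  exact_mod_cast h'

/-- `primesEquiv` of the place over `q` is `q`. [folklore] -/
theorem primesEquiv_symm_val (q : ℕ) (hq : q.Prime) :
    ((Rat.HeightOneSpectrum.primesEquiv (R := 𝓞 ℚ)
      ((Rat.HeightOneSpectrum.primesEquiv (R := 𝓞 ℚ)).symm ⟨q, hq⟩) : ℕ)) = q :=
  congrArg Subtype.val ((Rat.HeightOneSpectrum.primesEquiv (R := 𝓞 ℚ)).apply_symm_apply ⟨q, hq⟩)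

/-- `v_q(q) = exp(−1)`. [folklore] -/
theorem valuation_prime (q : ℕ) (hq : q.Prime) :
    ((Rat.HeightOneSpectrum.primesEquiv (R := 𝓞 ℚ)).symm ⟨q, hq⟩).valuation ℚ (q : ℚ) = WithZero.exp (-1 : ℤ) := by
  rw [← map_natCast (algebraMap (𝓞 ℚ) ℚ) q, HeightOneSpectrum.valuation_of_algebraMap]
  exact HeightOneSpectrum.intValuation_singleton _ (by exact_mod_cast hq.ne_zero) (asIdeal_eq_span q hq)

/-- `exp(−1)^k = exp(−k)` in `ℤᵐ⁰`. [folklore] -/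
theorem exp_neg_one_pow (k : ℕ) : (WithZero.exp (-1 : ℤ)) ^ k = WithZero.exp (-(k : ℤ)) := by
  induction k with
  | zero => simp
  | succ k ih => rw [pow_succ, ih, ← WithZero.exp_add]; push_cast; ring_nf

/-! ## §2 An integer model at the place over `q`: integrality, `c₄` a unit, `ord_q Δ = k` -/

/-- An integer Weierstrass model is integral at every finite place of `ℚ`. [cite: SilvermanAEC2009, VII.1 Remark 1.1] -/
theorem isIntegralAt_map (E : WeierstrassCurve ℤ) (v : HeightOneSpectrum (𝓞 ℚ)) :
    (E.map (Int.castRingHom ℚ)).IsIntegralAt v := by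
  refine isIntegralAt_of_valuation_le_one v _ ?_ ?_ ?_ ?_ ?_
  · rw [map_a₁, eq_intCast]; exact Literature.NumberTheory.Automorphic.valuation_intCast_le_one v _
  · rw [map_a₂, eq_intCast]; exact Literature.NumberTheory.Automorphic.valuation_intCast_le_one v _
  · rw [map_a₃, eq_intCast]; exact Literature.NumberTheory.Automorphic.valuation_intCast_le_one v _
  · rw [map_a₄, eq_intCast]; exact Literature.NumberTheory.Automorphic.valuation_intCast_le_one v _
  · rw [map_a₆, eq_intCast]; exact Literature.NumberTheory.Automorphic.valuation_intCast_le_one v _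

/-- `q ∤ c₄(E)` ⇒ `v_q(c₄(E/ℚ)) = 1`. [cite: SilvermanAEC2009, VII.5 Prop. 5.1(b)] -/
theorem valuation_c₄_eq_one (E : WeierstrassCurve ℤ) (q : ℕ) (hq : q.Prime) (hc4 : ¬ (q : ℤ) ∣ E.c₄) :
    ((Rat.HeightOneSpectrum.primesEquiv (R := 𝓞 ℚ)).symm ⟨q, hq⟩).valuation ℚ (E.map (Int.castRingHom ℚ)).c₄ = 1 := by
  rw [map_c₄, eq_intCast]
  refine Literature.NumberTheory.Automorphic.valuation_intCast_eq_one_of_not_dvd _ ?_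
  rw [primesEquiv_symm_val]
  exact hc4

/-- `Δ(E) = q^k · D` with `q ∤ D` ⇒ `v_q(Δ(E/ℚ)) = exp(−k)`. [cite: SilvermanAEC2009, VII.1 Remark 1.1] -/
theorem valuation_Δ_eq (E : WeierstrassCurve ℤ) (q : ℕ) (hq : q.Prime) (k : ℕ) (D : ℤ) (hΔ : E.Δ = q ^ k * D)
    (hD : ¬ (q : ℤ) ∣ D) :
    ((Rat.HeightOneSpectrum.primesEquiv (R := 𝓞 ℚ)).symm ⟨q, hq⟩).valuation ℚ (E.map (Int.castRingHom ℚ)).Δ =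
      WithZero.exp (-(k : ℤ)) := by
  rw [map_Δ, eq_intCast, hΔ, Int.cast_mul, Int.cast_pow, map_mul, map_pow, Int.cast_natCast, valuation_prime,
    Literature.NumberTheory.Automorphic.valuation_intCast_eq_one_of_not_dvd _ (by rw [primesEquiv_symm_val]; exact hD),
    mul_one, exp_neg_one_pow]

/-- **Multiplicative reduction at the place over `q`** for an integer model with `q ∤ c₄` and `q ∣ Δ` (`Δ = q^k D`, `k ≥ 1`).
[cite: SilvermanAEC2009, VII.5 Prop. 5.1(b)] -/
theorem hasMultiplicativeReductionAt (E : WeierstrassCurve ℤ) (q : ℕ) (hq : q.Prime) (hc4 : ¬ (q : ℤ) ∣ E.c₄)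
    (k : ℕ) (hk0 : 0 < k) (D : ℤ) (hΔ : E.Δ = q ^ k * D) (hD : ¬ (q : ℤ) ∣ D) :
    (E.map (Int.castRingHom ℚ)).HasMultiplicativeReductionAt ((Rat.HeightOneSpectrum.primesEquiv (R := 𝓞 ℚ)).symm ⟨q, hq⟩) := by
  have hE : E.Δ ≠ 0 := by
    intro h0; apply hD; rw [h0] at hΔ
    rcases mul_eq_zero.mp hΔ.symm with h | h
    · exact absurd (pow_eq_zero_iff (Nat.pos_iff_ne_zero.mp hk0) |>.mp h) (by exact_mod_cast hq.ne_zero)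
    · rw [h]; exact dvd_zero _
  haveI := Summit.BirchSwinnertonDyer.Rank2.isElliptic_map_of_Δ_ne_zero E hE
  refine hasMultiplicativeReductionAt_of_valuation_c₄_eq_one (isIntegralAt_map E _) (valuation_c₄_eq_one E q hq hc4) ?_
  rw [valuation_Δ_eq E q hq k D hΔ hD, ← WithZero.exp_zero]
  exact WithZero.exp_lt_exp.mpr (by omega)

/-- **`ord_q(Δ_min) = k`** for an integer model with `q ∤ c₄` (minimal at `q`) and `Δ = q^k D`, `q ∤ D`.
[cite: SilvermanAEC2009, VII.1 Remark 1.1] -/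
theorem ordMinimalDiscriminant_eq (E : WeierstrassCurve ℤ) (hE : E.Δ ≠ 0) (q : ℕ) (hq : q.Prime)
    (hc4 : ¬ (q : ℤ) ∣ E.c₄) (k : ℕ) (D : ℤ) (hΔ : E.Δ = q ^ k * D) (hD : ¬ (q : ℤ) ∣ D) :
    (E.map (Int.castRingHom ℚ)).ordMinimalDiscriminant ((Rat.HeightOneSpectrum.primesEquiv (R := 𝓞 ℚ)).symm ⟨q, hq⟩) = k := by
  haveI := Summit.BirchSwinnertonDyer.Rank2.isElliptic_map_of_Δ_ne_zero E hE
  set v := (Rat.HeightOneSpectrum.primesEquiv (R := 𝓞 ℚ)).symm ⟨q, hq⟩ with hv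
  have hmin := isMinimalAt_of_lt_valuation_c₄ (isIntegralAt_map E v)
    (by rw [valuation_c₄_eq_one E q hq hc4, ← WithZero.exp_zero]; exact WithZero.exp_lt_exp.mpr (by norm_num))
  have h1 := valuation_Δ_eq_of_isMinimalAt_holds v _ hmin
  rw [valuation_Δ_eq E q hq k D hΔ hD, WithZero.exp_inj, neg_inj] at h1
  exact_mod_cast h1.symm

/-! ## §3 The image of `Γ_ℚ` on `E[l]` for an integer model: irreducible + an explicit multiplicative place ⇒ `⊇ SL₂(𝔽_l)` -/

/-- **`Im(Γ_ℚ → Aut E[l]) ⊇ SL₂(𝔽_l)` from irreducibility and ONE multiplicative prime `q ≠ l` with `l ∤ ord_q(Δ_min)`**, for an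
integer model `E` with `q ∤ c₄(E)`, `Δ(E) = q^k D`, `q ∤ D`, `l ∤ k`: [GenEll] Lem. 3.1 (iii) with the Tate-curve transvection (the
tree's `EllPoint.imageModLContainsSL2_of_not_admitsLCyclic_of_hasMultiplicativeReductionAt`). [cite: MochizukiGenEll2010, Lem 3.1 (iii) p.14] -/
theorem imageModLContainsSL2_map (E : WeierstrassCurve ℤ) (hE : E.Δ ≠ 0) (l : ℕ) [Fact l.Prime]
    (hirr : (E.map (Int.castRingHom ℚ)).HasIrreducibleModPGaloisRep l)
    (q : ℕ) (hq : q.Prime) (hql : ¬ q ∣ l) (hc4 : ¬ (q : ℤ) ∣ E.c₄) (k : ℕ) (hk0 : 0 < k) (hk : ¬ l ∣ k)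
    (D : ℤ) (hΔ : E.Δ = q ^ k * D) (hD : ¬ (q : ℤ) ∣ D) :
    (@EllPoint.mk ℚ _ _ (E.map (Int.castRingHom ℚ))
      (Summit.BirchSwinnertonDyer.Rank2.isElliptic_map_of_Δ_ne_zero E hE)).ImageModLContainsSL2 l := by
  haveI := Summit.BirchSwinnertonDyer.Rank2.isElliptic_map_of_Δ_ne_zero E hE
  set P : EllPoint := @EllPoint.mk ℚ _ _ (E.map (Int.castRingHom ℚ))
      (Summit.BirchSwinnertonDyer.Rank2.isElliptic_map_of_Δ_ne_zero E hE) with hP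
  have hno : ¬ P.AdmitsLCyclic l := fun hcyc =>
    (Mazur1978.not_hasIrreducibleModPGaloisRep_iff_exists_natCard_eq P.W l).mpr hcyc hirr
  exact P.imageModLContainsSL2_of_not_admitsLCyclic_of_hasMultiplicativeReductionAt l hno
    (hasMultiplicativeReductionAt E q hq hc4 k hk0 D hΔ hD) (natCast_not_mem_asIdeal q hq hql)
    (by rw [ordMinimalDiscriminant_eq E hE q hq hc4 k D hΔ hD]; exact hk)

/-! ## §4 The Frey–Legendre model `[0, −(c²+ac), 0, ac³, 0]` and the Legendre curve `y² = x(x−1)(x−λ)`, `λ = a/c` -/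

/-- `Δ([0, −(c²+ac), 0, ac³, 0]) = 16·a²·c⁸·(c−a)²` (`= 16a²b²c⁸` for `a + b = c`). [cite: SilvermanAEC2009, III.1 (b₂, b₄, b₆, b₈, Δ)] -/
theorem Δ_model (a c : ℕ) :
    ((⟨0, -(((c : ℕ) : ℤ) ^ 2 + (a : ℕ) * (c : ℕ)), 0, ((a : ℕ) : ℤ) * ((c : ℕ) : ℤ) ^ 3, 0⟩ : WeierstrassCurve ℤ)).Δ =
      16 * ((a : ℕ) : ℤ) ^ 2 * ((c : ℕ) : ℤ) ^ 8 * (((c : ℕ) : ℤ) - (a : ℕ)) ^ 2 := by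
  simp only [WeierstrassCurve.Δ, WeierstrassCurve.b₂, WeierstrassCurve.b₄, WeierstrassCurve.b₆, WeierstrassCurve.b₈]
  ring

/-- `c₄([0, −(c²+ac), 0, ac³, 0]) = 16·c²·(c² − ac + a²)`. [cite: SilvermanAEC2009, III.1 (b₂, b₄, c₄)] -/
theorem c₄_model (a c : ℕ) :
    ((⟨0, -(((c : ℕ) : ℤ) ^ 2 + (a : ℕ) * (c : ℕ)), 0, ((a : ℕ) : ℤ) * ((c : ℕ) : ℤ) ^ 3, 0⟩ : WeierstrassCurve ℤ)).c₄ =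
      16 * ((c : ℕ) : ℤ) ^ 2 * (((c : ℕ) : ℤ) ^ 2 - (a : ℕ) * (c : ℕ) + ((a : ℕ) : ℤ) ^ 2) := by
  simp only [WeierstrassCurve.c₄, WeierstrassCurve.b₂, WeierstrassCurve.b₄]
  ring

/-- The Legendre model `[0, −(1+λ), 0, λ, 0]`, `λ = a/c ∉ {0, 1}`, is elliptic. [cite: SilvermanAEC2009, Prop. III.1.7] -/
theorem isElliptic_legendre (a c : ℕ) (ha : a ≠ 0) (hc : c ≠ 0) (hac : a ≠ c) :
    (⟨0, -(1 + ((a : ℕ) : ℚ) / (c : ℕ)), 0, ((a : ℕ) : ℚ) / (c : ℕ), 0⟩ : WeierstrassCurve ℚ).IsElliptic := by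
  refine (legendre_isElliptic_iff (F := ℚ) two_ne_zero _).2 ⟨?_, ?_⟩
  · exact div_ne_zero (by exact_mod_cast ha) (by exact_mod_cast hc)
  · intro h
    rw [div_eq_one_iff_eq (by exact_mod_cast hc)] at h
    exact hac (by exact_mod_cast h)

/-- `⟨c, 0, 0, 0⟩ • [0, −(c²+ac), 0, ac³, 0] = [0, −(1+λ), 0, λ, 0]` over `ℚ` (rescaling `u = c`). [cite: SilvermanAEC2009, III.1 Table 3.1] -/
theorem variableChange_model_eq_legendre (a c : ℕ) (hc : c ≠ 0) :
    (⟨Units.mk0 ((c : ℕ) : ℚ) (by exact_mod_cast hc), 0, 0, 0⟩ : VariableChange ℚ) •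
      ((⟨0, -(((c : ℕ) : ℤ) ^ 2 + (a : ℕ) * (c : ℕ)), 0, ((a : ℕ) : ℤ) * ((c : ℕ) : ℤ) ^ 3, 0⟩ : WeierstrassCurve ℤ).map
        (Int.castRingHom ℚ)) =
      (⟨0, -(1 + ((a : ℕ) : ℚ) / (c : ℕ)), 0, ((a : ℕ) : ℚ) / (c : ℕ), 0⟩ : WeierstrassCurve ℚ) := by
  have hc' : ((c : ℕ) : ℚ) ≠ 0 := by exact_mod_cast hc
  ext
  · simp [variableChange_a₁]
  · rw [variableChange_a₂]; simp [Units.val_inv_eq_inv_val]; try field_simp; try ring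
  · simp [variableChange_a₃]
  · rw [variableChange_a₄]; simp [Units.val_inv_eq_inv_val]; try field_simp; try ring
  · simp [variableChange_a₆]

/-- **(P6) ENGINE for Frey–Legendre data.** Let `λ = a/c` (`a, c ≠ 0`, `a ≠ c`), `E₁ = [0, −(c²+ac), 0, ac³, 0]` the integer model of
`y² = x(x−1)(x−λ)`, `l ∤ 46080` a prime. GIVEN (i) a good prime `p ≠ l` of `E₁` (`p ∤ Δ(E₁)`) at which `X² − a_p X + p` has no root mod
`l` (`a_p = p + 1 − #Ẽ₁(𝔽_p)`, the tree's `Automorphic.frobeniusTrace`) — Mazur's Frobenius certificate, so `ρ̄_{E,l}` is irreducible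
over `ℚ` (`hasIrreducibleModPGaloisRep_map_of_noroot`) — and (ii) a prime `q ∤ l` with `q ∤ c₄(E₁)`, `Δ(E₁) = q^k·D`, `q ∤ D`, `k ≥ 1`,
`l ∤ k` (a multiplicative place with `l ∤ ord_q Δ_min`, Tate transvection), THEN `Cor22.CondP6 (ratPoint λ) l`: the image of
`Gal(F̄/F)` on `E_F[l]` contains `SL₂(𝔽_l)` for every theta-field `F` ([IUTchIV] Cor. 2.2 (ii) (P6) p. 46), by [GenEll] Lem. 3.1 (iii)
over `ℚ`, the change of model, and transport UP the Galois extension `F/ℚ` of degree `∣ 46080` prime to `l`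
(`EllPoint.imageModLContainsSL2_map_of_isGalois_of_not_dvd`). Every numeric hypothesis is decidable at a datum.
[cite: Mochizuki2012, IUTchIV Cor. 2.2 (ii) (P6) p.46] [cite: Mazur1978, §6 Prop. 6.3 (1) (p. 153)] -/
theorem condP6_ratPoint_of_certificate (a c : ℕ) (ha : a ≠ 0) (hc : c ≠ 0) (hac : a ≠ c)
    (l : ℕ) [Fact l.Prime] (h46080 : ¬ l ∣ 46080)
    (p : ℕ) [Fact p.Prime] (hpl : p ≠ l)
    (hpΔ : ¬ (p : ℤ) ∣ ((⟨0, -(((c : ℕ) : ℤ) ^ 2 + (a : ℕ) * (c : ℕ)), 0, ((a : ℕ) : ℤ) * ((c : ℕ) : ℤ) ^ 3, 0⟩ : WeierstrassCurve ℤ)).Δ)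
    (hnoroot : ∀ t : ZMod l, t ^ 2 - (Literature.NumberTheory.Automorphic.frobeniusTrace
        (⟨0, -(((c : ℕ) : ℤ) ^ 2 + (a : ℕ) * (c : ℕ)), 0, ((a : ℕ) : ℤ) * ((c : ℕ) : ℤ) ^ 3, 0⟩ : WeierstrassCurve ℤ) p : ZMod l) * t
        + (p : ZMod l) ≠ 0)
    (q : ℕ) (hq : q.Prime) (hql : ¬ q ∣ l)
    (hc4 : ¬ (q : ℤ) ∣ ((⟨0, -(((c : ℕ) : ℤ) ^ 2 + (a : ℕ) * (c : ℕ)), 0, ((a : ℕ) : ℤ) * ((c : ℕ) : ℤ) ^ 3, 0⟩ : WeierstrassCurve ℤ)).c₄)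
    (k : ℕ) (hk0 : 0 < k) (hk : ¬ l ∣ k) (D : ℤ)
    (hΔ : ((⟨0, -(((c : ℕ) : ℤ) ^ 2 + (a : ℕ) * (c : ℕ)), 0, ((a : ℕ) : ℤ) * ((c : ℕ) : ℤ) ^ 3, 0⟩ : WeierstrassCurve ℤ)).Δ = q ^ k * D)
    (hD : ¬ (q : ℤ) ∣ D) :
    Cor22.CondP6 (ratPoint (((a : ℕ) : ℚ) / (c : ℕ))) l := by
  intro hU F _ _ iA hF _
  set E : WeierstrassCurve ℤ :=
    ⟨0, -(((c : ℕ) : ℤ) ^ 2 + (a : ℕ) * (c : ℕ)), 0, ((a : ℕ) : ℤ) * ((c : ℕ) : ℤ) ^ 3, 0⟩ with hEdef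
  have hE : E.Δ ≠ 0 := fun h0 => hpΔ (h0 ▸ dvd_zero _)
  -- irreducible over `ℚ` (Mazur's Frobenius certificate)
  have hirr : (E.map (Int.castRingHom ℚ)).HasIrreducibleModPGaloisRep l :=
    Summit.BirchSwinnertonDyer.Rank2.hasIrreducibleModPGaloisRep_map_of_noroot E l p hpl hpΔ hnoroot
  -- `⊇ SL₂(𝔽_l)` over `ℚ` for the integer model, then for the Legendre model
  have hmodel := imageModLContainsSL2_map E hE l hirr q hq hql hc4 k hk0 hk D hΔ hD
  have hleg := @EllPoint.imageModLContainsSL2_of_variableChange_eq ℚ _ _ _ _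
    (Summit.BirchSwinnertonDyer.Rank2.isElliptic_map_of_Δ_ne_zero E hE) (isElliptic_legendre a c ha hc hac) _
    (variableChange_model_eq_legendre a c hc) l _ hmodel
  -- `[F : ℚ] ∣ 46080` is prime to `l`
  have hdeg : ¬ l ∣ Module.finrank (ratPoint (((a : ℕ) : ℚ) / (c : ℕ))).F F :=
    fun h => h46080 (h.trans hF.finrank_dvd)
  -- UP from `ℚ` to the Galois extension `F`
  have hup := @EllPoint.imageModLContainsSL2_map_of_isGalois_of_not_dvd
    (@EllPoint.mk ℚ _ _ (⟨0, -(1 + ((a : ℕ) : ℚ) / (c : ℕ)), 0, ((a : ℕ) : ℚ) / (c : ℕ), 0⟩ : WeierstrassCurve ℚ)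
      (isElliptic_legendre a c ha hc hac)) F _ _ iA l _ hF.isGalois hdeg hleg
  -- the base-changed Legendre model is `thetaCurve P F`
  have hW : (1 : VariableChange F) •
      ((⟨0, -(1 + ((a : ℕ) : ℚ) / (c : ℕ)), 0, ((a : ℕ) : ℚ) / (c : ℕ), 0⟩ : WeierstrassCurve ℚ).map (@algebraMap ℚ F _ _ iA)) =
      Cor22.thetaCurve (ratPoint (((a : ℕ) : ℚ) / (c : ℕ))) F := by
    rw [one_smul]
    ext <;> simp [ratPoint, WeierstrassCurve.map]
  exact @EllPoint.imageModLContainsSL2_of_variableChange_eq F _ _ _ _ (_) (Cor22.thetaCurve_isElliptic hU F) 1 hW l _ hup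

end FreyP6Engine

end Summit.ABC.IUTFork.Conditional

end
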